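import Summits.HodgeConjecture.HodgeConjecture.Theorems.CyclicUnitaryPowersNodalPencilCircleDatum
import Summits.HodgeConjecture.HodgeConjecture.Theorems.CyclicUnitaryPowersNodalMeridianOfCircle
import HarnessLib

/-!
# K1-A: the nodal-meridian local-monodromy fact F1‡ `carlsonToledo1999_nodalMeridianLocalMonodromyBound` — PROVED
# (route `CyclicUnitaryPowers`, item stmt-HodgeConjecture-19544; programme "localisation", final assembly)

Prover seat `hodge-nonav-prover-Ax` (g10), cell `hodge-nonav`. Helper file `--supports stmt-HodgeConjecture-19544`; sorry-free; no
definition, no new named fact. It DISCHARGES the Literature named fact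
`Literature.AlgebraicGeometry.HodgeTheory.carlsonToledo1999_nodalMeridianLocalMonodromyBound` (Carlson–Toledo 1999 §6 (kdoublept),
bound form: the local monodromy of the universal family of `p`-cyclic covers of the plane around a one-nodal branch curve is
`1 + N` with `Σ_{i<p} Tⁱ N = 0` on an at most `(p−1)`-dimensional space) — the only Picard–Lefschetz input of the conditional
assembly of crux K1-A (`VeryGeneralDeckCommutatorsInHg`). Nothing here says HC ∕ HC_AV is proved: K1-A stays conditional on the
other two binders (PG, CDK) of its registry.

Proof (`carlsonToledo1999_nodalMeridianLocalMonodromyBound_holds`): by `nodalMeridianLocalMonodromyBound_at_of_circle` (all meridians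
of the irreducible discriminant are conjugate; leash conjugation) it suffices to treat the boundary circles of the explicit small
meridians centred at `f₁ = x₂^{p−2}x₀x₁ + x₀^p + x₁^p` with direction `x₂^p`; read through the coefficient chart `χ`, such a circle is a
loop of the Carlson–Toledo base whose branch forms are `f₁ + εe^{2πiu}·x₂^p` (`coeffVector_circle`), and for those the rational
transport exists and carries the datum by `exists_isRatTransport_datum_pencilCircle` (the geometric monodromy of the nodal pencil,
programme "localisation": Morse chart, shell-tangent lifts, fold isotopy, shell interpolation with the Pham–Brieskorn model, Milnor's
fibre, Mayer–Vietoris localisation, transport = holonomy).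

## References

* [CarlsonToledo1999] J. A. Carlson, D. Toledo, Duke Math. J. 97 (1999), §3, §6 (kdoublept) (held text p0006, p0013–p0014).
* [ArnoldGuseinzadeVarchenko2012] V. I. Arnold, S. M. Gusein-Zade, A. N. Varchenko, Singularities of Differentiable Maps II, Part I §1.1, §2.1.
* [Milnor1968] J. Milnor, Singular Points of Complex Hypersurfaces, §9.
* [VoisinHodgeII2003] C. Voisin, Hodge Theory and Complex Algebraic Geometry II, §2.3, §3.1.2.
-/

set_option linter.dupNamespace false

noncomputable section

open CategoryTheory AlgebraicGeometry MvPolynomial TopologicalSpace Set Topology Filter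
open scoped Real unitInterval
open Literature.AlgebraicGeometry.Motives Literature.AlgebraicGeometry.Motives.UniversalHypersurface
open Literature.AlgebraicGeometry.HodgeTheory Literature.AlgebraicGeometry.HodgeTheory.UniversalHypersurface
open Literature.AlgebraicGeometry.FundamentalGroup
open Literature.AlgebraicTopology.SingularHomology
open Summit.HodgeConjecture.HodgeConjecture.Theorems.CyclicUnitaryPowersUninodalTernaryForm
open Summit.HodgeConjecture.HodgeConjecture.Theorems.CyclicUnitaryPowersNodalMeridianOfCircle
open Summit.HodgeConjecture.HodgeConjecture.Theorems.CyclicUnitaryPowersNodalPencilPackage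
open Summit.HodgeConjecture.HodgeConjecture.Theorems.CyclicUnitaryPowersNodalPencilCircleDatum

namespace Summit.HodgeConjecture.HodgeConjecture.Theorems.CyclicUnitaryPowersNodalMeridianMonodromy

/-! ### §1 The branch forms along the circle of the explicit meridian -/

/-- **The ternary form with coefficient vector `coeffsOf f₁ + c·e_{x₂^p}` is `f₁ + c x₂^p`** (`p = m + 3`).
[cite: CarlsonToledo1999, §6 (kdoublept)] -/
theorem sum_monomial_nodalCircle (m : ℕ) (c : ℂ) :
    (∑ e : TernaryIndex (m + 3), monomial e.1
        ((coeffsOf 1 (m + 3) (X 2 ^ (m + 1) * (X 0 * X 1) + X 0 ^ (m + 3) + X 1 ^ (m + 3)) +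
          c • (Pi.single (⟨Finsupp.single (2 : Fin 3) (m + 3), degree_single_two (m + 3)⟩ : TernaryIndex (m + 3)) (1 : ℂ) :
            TernaryIndex (m + 3) → ℂ)) e)) =
      (X 2 ^ (m + 1) * (X 0 * X 1) + X 0 ^ (m + 3) + X 1 ^ (m + 3)) + c • X 2 ^ (m + 3) := by
  classical
  set w : TernaryIndex (m + 3) → ℂ := coeffsOf 1 (m + 3) (X 2 ^ (m + 1) * (X 0 * X 1) + X 0 ^ (m + 3) + X 1 ^ (m + 3)) +
    c • (Pi.single (⟨Finsupp.single (2 : Fin 3) (m + 3), degree_single_two (m + 3)⟩ : TernaryIndex (m + 3)) (1 : ℂ) :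
      TernaryIndex (m + 3) → ℂ) with hw
  have hRHS : ((X 2 ^ (m + 1) * (X 0 * X 1) + X 0 ^ (m + 3) + X 1 ^ (m + 3)) + c • X 2 ^ (m + 3) :
      MvPolynomial (Fin 3) ℂ).IsHomogeneous (m + 3) := by
    rw [smul_eq_C_mul]
    refine (isHomogeneous_nodalTernaryForm m).add ?_
    simpa using (isHomogeneous_C (Fin 3) c).mul ((isHomogeneous_X ℂ (2 : Fin 3)).pow (m + 3))
  refine MvPolynomial.ext _ _ fun e => ?_
  by_cases he : e.degree = m + 3
  · have h1 := coeff_sum_monomial (m + 3) w ⟨e, he⟩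
    change coeff e _ = _ at h1
    rw [h1, hw, Pi.add_apply, Pi.smul_apply, coeffsOf_apply, smul_eq_mul]
    conv_rhs => rw [coeff_add, coeff_smul, coeff_X_pow, smul_eq_mul]
    congr 1
    by_cases h2 : Finsupp.single (2 : Fin 3) (m + 3) = e
    · subst h2
      rw [if_pos rfl, Pi.single_eq_same]
    · rw [if_neg h2, Pi.single_eq_of_ne (fun h => h2 (congrArg Subtype.val h).symm)]
  · rw [(isHomogeneous_sum_monomial (m + 3) w).coeff_eq_zero he, hRHS.coeff_eq_zero he]

/-- **Along the boundary circle of the explicit meridian, read through a coefficient chart, the quaternary coefficient vectors are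
`b(x₃^p − f₁) − εe^{2πiu}·e_{x₂^p}`.** [cite: CarlsonToledo1999, §2 (held text p0004), §6 (kdoublept)] -/
theorem coeffVector_circle {m : ℕ} {D : MvPolynomial (TernaryIndex (m + 3)) ℂ}
    (χ : ComplexPoints (cyclicCoverBase (m + 3)) ≃ₜ affineHypersurfaceComplement ![D]) (hχ : IsCoefficientChart (m + 3) D χ)
    {b : affineHypersurfaceComplement ![D]} (μ : Meridian ![D] b 0)
    (hy : μ.y = coeffsOf 1 (m + 3) (X 2 ^ (m + 1) * (X 0 * X 1) + X 0 ^ (m + 3) + X 1 ^ (m + 3)))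
    (hv : μ.v = Pi.single ⟨Finsupp.single (2 : Fin 3) (m + 3), degree_single_two (m + 3)⟩ 1) (u : I) :
    coeffVector ℂ 2 (m + 3) (AlgPoints.map (toBaseSpz ℂ 2 (m + 3) (cyclicCoverSpz (m + 3))) ((μ.circle.map χ.symm.continuous) u)) =
      coeffsOf 2 (m + 3) (cyclicCoverForm (m + 3) (X 2 ^ (m + 3 - 2) * (X 0 * X 1) + X 0 ^ (m + 3) + X 1 ^ (m + 3))) -
        Pi.single (regPowIndex 2 (m + 3) 2) (Complex.exp (((2 * π * u : ℝ) : ℂ) * Complex.I) * μ.ε) := by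
  haveI : NeZero (m + 3) := ⟨by omega⟩
  set t : ComplexPoints (cyclicCoverBase (m + 3)) := (μ.circle.map χ.symm.continuous) u with ht
  set c : ℂ := Complex.exp (((2 * π * u : ℝ) : ℂ) * Complex.I) * μ.ε with hc
  -- the branch form of `t` is `f₁ + c x₂^p`
  have hχt : (χ t : TernaryIndex (m + 3) → ℂ) = μ.circlePoint u := by
    rw [ht, Path.map_coe, Function.comp_apply, χ.apply_symm_apply, Meridian.coe_circle_apply]
  have hcoeff : ∀ e : TernaryIndex (m + 3), (branchForm (m + 3) t).coeff e.1 = (μ.y + c • μ.v) e := by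
    intro e
    rw [← hχ t e, hχt, Meridian.circlePoint, discPoint, hc]
    push_cast
    ring
  have hbranch : branchForm (m + 3) t = (X 2 ^ (m + 1) * (X 0 * X 1) + X 0 ^ (m + 3) + X 1 ^ (m + 3)) + c • X 2 ^ (m + 3) := by
    rw [← sum_monomial_coeff_branchForm, ← sum_monomial_nodalCircle m c]
    refine Finset.sum_congr rfl fun e _ => ?_
    rw [hcoeff e, hy, hv]
  funext mm
  have key := formOfCoeffs_nodalPencil (p := m + 3) (by omega) c
  rw [show m + 3 - 2 = m + 1 by omega] at key ⊢
  rw [coeffVector_map_toBaseSpz, sum_monomial_coeff_branchForm, hbranch, ← key, coeff_formOfCoeffs]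

/-! ### §2 F1‡ -/

/-- **The geometric input `hG` of `nodalMeridianLocalMonodromyBound_of_circle`**: for `p ≥ 3` there is `ε₀ > 0` such that for every
irreducible equation `D` of the discriminant, coefficient chart `χ` and meridian `μ` with centre `f₁`, direction `x₂^p` and radius
`≤ ε₀`, the rational transport along the boundary circle of `μ` read in `S(ℂ)` exists and carries the local-monodromy datum.
[cite: CarlsonToledo1999, §6 (kdoublept) (held text p0013–p0014)] -/
theorem circle_datum {p : ℕ} [NeZero p] (hp3 : 3 ≤ p) :
    ∃ ε₀ : ℝ, 0 < ε₀ ∧ ∀ (D : MvPolynomial (TernaryIndex p) ℂ), Irreducible D → IsDiscriminantEquation p D →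
      ∀ (χ : ComplexPoints (cyclicCoverBase p) ≃ₜ affineHypersurfaceComplement ![D]), IsCoefficientChart p D χ →
      ∀ {b : affineHypersurfaceComplement ![D]} (μ : Meridian ![D] b 0),
        μ.y = coeffsOf 1 p (X 2 ^ (p - 3 + 1) * (X 0 * X 1) + X 0 ^ (p - 3 + 3) + X 1 ^ (p - 3 + 3)) →
        μ.v = Pi.single ⟨Finsupp.single (2 : Fin 3) p, degree_single_two p⟩ 1 → μ.ε ≤ ε₀ →
        ∃ T : bettiCohomology (fiberOver (cyclicCoverFamily p) (χ.symm μ.leashEnd)) 2 ≃ₗ[ℚ]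
            bettiCohomology (fiberOver (cyclicCoverFamily p) (χ.symm μ.leashEnd)) 2,
          IsRatTransport (cyclicCoverFamily p) 2 (cyclicCoverFamily_locallyTrivial p)
            (cyclicCoverLoopClass p (μ.circle.map χ.symm.continuous)) T ∧
          ∃ V : Submodule ℚ (bettiCohomology (fiberOver (cyclicCoverFamily p) (χ.symm μ.leashEnd)) 2),
            (∀ x, T x - x ∈ V) ∧ (∀ v ∈ V, (∑ i ∈ Finset.range p, (T ^ i) v) = 0) ∧ Module.finrank ℚ V ≤ p - 1 := by
  obtain ⟨m, rfl⟩ : ∃ m, p = m + 3 := ⟨p - 3, by omega⟩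
  obtain ⟨ε₀, hε₀, hcirc⟩ := exists_isRatTransport_datum_pencilCircle (p := m + 3) hp3
  refine ⟨ε₀ / 2, by positivity, fun D _ _ χ hχ b μ hy hv hε => ?_⟩
  simp only [show m + 3 - 3 = m by omega] at hy
  have hε0 : ((μ.ε : ℝ) : ℂ) ≠ 0 := by exact_mod_cast μ.ε_pos.ne'
  have hεn : ‖((μ.ε : ℝ) : ℂ)‖ < ε₀ := by
    rw [Complex.norm_real, Real.norm_eq_abs, abs_of_pos μ.ε_pos]; linarith
  obtain ⟨T, V, hT, hV₁, hV₂, hV₃⟩ := hcirc (μ.ε : ℂ) hε0 hεn (μ.circle.map χ.symm.continuous)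
    (fun u => coeffVector_circle χ hχ μ hy hv u)
  exact ⟨T, hT, V, hV₁, hV₂, hV₃⟩

/-- **F1‡ proved: the nodal-meridian local-monodromy bound of Carlson–Toledo 1999 §6 (kdoublept).**
[cite: CarlsonToledo1999, §6 (kdoublept) and §3 (held text p0006, p0013–p0014)] -/
theorem carlsonToledo1999_nodalMeridianLocalMonodromyBound_holds : carlsonToledo1999_nodalMeridianLocalMonodromyBound := by
  intro p _ _ hp3 f _ _ _ D hirr hDeq χ hχ μ _ γ hγ
  exact nodalMeridianLocalMonodromyBound_at_of_circle hp3 (circle_datum hp3) f D hirr hDeq χ hχ μ γ hγ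

end Summit.HodgeConjecture.HodgeConjecture.Theorems.CyclicUnitaryPowersNodalMeridianMonodromy

end
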